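import Summits.ValiantsHypothesis.ValiantsHypothesis.Theorems.LacunarySymmetroidMatrixDescartesDoorA26WallBubblingTightChain
import Summits.ValiantsHypothesis.ValiantsHypothesis.Theorems.LacunarySymmetroidMatrixDescartesDoorA26WallBubblingWeylGenericSingleCluster

/-!
# Wall bubbling for `DoorA26` — (W) at generic Weyl faces: THE REDUCTION TO THE CONFLUENT DOOR AND THE TIGHT-CHAIN RESIDUAL, END TO END

HONEST FRAMING.  Obligation (W) `stub_weylFaces` of `Cruxes/DoorA26/Lines/wall_bubbling.lean` (crux `DoorA26`, stmt-ValiantsHypothesis-19979;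
OPEN, typed, never asserted); statement file `Cruxes/DoorA26/Lines/wall_bubbling_ConfluentDoor.lean` rev 4 (line lead val-idea-15): target shape
`Stmt.weylFaces_generic_of_confluentDoor := ConfluentDoor26 → Stmt.weylFaces_generic`, found INSUFFICIENT by the chain count (W2 g14 paper flag,
desk R2757/R2761: the ceiling is 20 for every number of clusters, #17 `chain_ceiling_attained_two_clusters`).  W2 seat val-sym-door-p1 g15.

THIS FILE closes the books on (W) at generic faces MODULO TWO NAMED INPUTS, both inlined verbatim as hypotheses (def-free; `Cruxes/` is not importable):
* `hdoor` = `ConfluentDoor26` (rev 3/4, log-currency, with multiplicity) — kills the ONE-CLUSTER accumulations (W2 #7/#16);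
* `hchain` = **THE TIGHT-CHAIN RESIDUAL** «no tight confluent chain with at least two clusters»: literally the hypotheses of the structure theorem
  `…TightChain.tightChain` (positions `0, 5`, 2-Sidon `δ0 ∘ castSucc`, genuine pencils `≢ 0` with twenty strictly increasing zeros anywhere)
  followed by ITS CONCLUSIONS (one subsequence; clusters with `Σ m c = 20`, `m c ≥ 1`, centres drifting apart, recentred zeros in a common window;
  Gram-normalisation packages; `|V| = 15`; Laguerre–Pólya sharpness of every cluster; member-form monotonicity; tight interval count `= 14`; tight
  slot splitting value by value) and `2 ≤ C`, concluding `False`.  This is the (W-split) gap of register R2761 in the sharpest form the kernel now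
  supports: every counterexample to (W) at a generic face is, after extraction, a TIGHT CHAIN OF ≥ 2 CONFLUENT CLUSTERS.
and proves `weylFaces_generic_of_confluentDoor_of_noTightChain : hdoor → hchain → Stmt.weylFaces_generic` with the line's definitions unfolded to
the Theorems-side verbatim copies `Bubbling.SortedSimplex`, `Bubbling.TwentyLocus` (p618256) and `IsGenericWeylFace` inlined.  Entrance:
`mem_closure_iff_seq_limit`, `twenty_log_zeros_of_mem_twentyLocus` (twenty log-zeros and non-vanishing from `ncard ≥ 20`), relabelling
`exists_perm_weylPair` / `sidon_of_injOn` (#16); middle: `tightChain` (#26); exits: `C = 1` by #16 `no_twenty_window_weyl05_of_confluentDoor`,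
`C ≥ 2` by `hchain`.

Registers unchanged; (W)/(W-split)/`ConfluentDoor26`/`DoorA26`/`MatrixDescartes` (stmt-ValiantsHypothesis-18050) OPEN; nothing on VP ≠ VNP.  No new definitions.

[folklore] metric closure, logarithmic coordinates, relabelling.  [this work] the reduction.
-/

-- `Summit.ValiantsHypothesis.ValiantsHypothesis.…` repeats a component by the D-0017 layout
-- (single-conjunct summit), which the `dupNamespace` linter flags; the name is mandated.
set_option linter.dupNamespace false

namespace Summit.ValiantsHypothesis.ValiantsHypothesis.Theorems.LacunarySymmetroidMatrixDescartes.WallBubbling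

open Finset Filter Topology
open Bubbling (polar TwentyLocus SortedSimplex det_rpow_pencil rpow_exp_eq)
open scoped BigOperators

/-! ## 1. Entrance: twenty log-zeros of a point of the twenty-locus -/

/-- Along `x = e^t` the real-exponent pencil is the exponential pencil. [folklore] -/
theorem pencil_rpow_exp (δ : Fin 6 → ℝ) (S : Fin 6 → Matrix (Fin 2) (Fin 2) ℝ) (t : ℝ) :
    ∑ l, ((Real.exp t) ^ (δ l)) • S l = ∑ l, Real.exp (δ l * t) • S l := by
  refine Finset.sum_congr rfl fun l _ => ?_
  rw [rpow_exp_eq]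

/-- **Entrance.**  A point `δ` of the twenty-locus carries symmetric letters whose exponential pencil `t ↦ det Σ_l e^{δ_l t}S_l` is not identically
zero and has twenty strictly increasing real zeros. [folklore] -/
theorem twenty_log_zeros_of_mem_twentyLocus {δ : Fin 6 → ℝ} (hδ : δ ∈ TwentyLocus) :
    ∃ S : Fin 6 → Matrix (Fin 2) (Fin 2) ℝ, (∀ l, (S l).IsSymm) ∧
      (∃ t, (∑ l, Real.exp (δ l * t) • S l).det ≠ 0) ∧
      ∃ z : Fin 20 → ℝ, StrictMono z ∧ ∀ j, (∑ l, Real.exp (δ l * z j) • S l).det = 0 := by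
  classical
  obtain ⟨S, hS, h20⟩ := hδ
  set Zpos : Set ℝ := {x : ℝ | 0 < x ∧ (∑ l, (x ^ (δ l)) • S l).det = 0} with hZpos
  refine ⟨S, hS, ?_, ?_⟩
  · -- not identically zero: otherwise the positive zero set is `(0, ∞)` and `ncard = 0`
    by_contra hall
    push Not at hall
    have hIoi : Zpos = Set.Ioi 0 := by
      ext x
      simp only [hZpos, Set.mem_setOf_eq, Set.mem_Ioi]
      refine ⟨fun h => h.1, fun h => ⟨h, ?_⟩⟩
      have := hall (Real.log x)
      rwa [← pencil_rpow_exp, Real.exp_log h] at this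
    have : Zpos.ncard = 0 := by rw [hIoi]; exact (Set.Ioi_infinite 0).ncard
    rw [this] at h20
    omega
  · -- twenty sorted positive zeros, then logarithms
    obtain ⟨T, hTsub, hTcard⟩ := Set.exists_subset_card_eq h20
    have hTfin : T.Finite := Set.finite_of_ncard_pos (by omega)
    set TF : Finset ℝ := hTfin.toFinset with hTF
    have hTFcard : TF.card = 20 := by
      rw [hTF, ← Set.ncard_eq_toFinset_card T hTfin]; exact hTcard
    let e : Fin 20 ↪o ℝ := TF.orderEmbOfFin hTFcard
    have heT : ∀ j, e j ∈ T := fun j => by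
      have h2 : e j ∈ hTfin.toFinset := Finset.orderEmbOfFin_mem TF hTFcard j
      exact hTfin.mem_toFinset.mp h2
    have hepos : ∀ j, 0 < e j := fun j => (hTsub (heT j)).1
    refine ⟨fun j => Real.log (e j), ?_, ?_⟩
    · intro i j hij
      exact Real.log_lt_log (hepos i) (e.strictMono hij)
    · intro j
      have hz := (hTsub (heT j)).2
      rw [← pencil_rpow_exp, Real.exp_log (hepos j)]
      exact hz

/-! ## 2. The reduction -/

/-- **(W) AT GENERIC WEYL FACES REDUCES TO THE CONFLUENT DOOR AND THE TIGHT-CHAIN RESIDUAL.**  See the module docstring: `hdoor` = `ConfluentDoor26`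
(inlined), `hchain` = «no tight confluent chain with `≥ 2` clusters» (the setting and the conclusions of `tightChain`, inlined, then `2 ≤ C → False`);
conclusion = `Stmt.weylFaces_generic` with `SortedSimplex`, `TwentyLocus` the Theorems-side verbatim copies and `IsGenericWeylFace` inlined.
[this work] -/
theorem weylFaces_generic_of_confluentDoor_of_noTightChain
    (hdoor : ∀ e : Fin 5 → ℝ, Function.Injective e →
      ∀ τ T : Matrix (Fin 2) (Fin 2) ℝ, ∀ S : Fin 4 → Matrix (Fin 2) (Fin 2) ℝ,
        τ.IsSymm → T.IsSymm → (∀ k, (S k).IsSymm) →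
        (∃ t, ((Real.exp (e 0 * t)) • (τ + t • T) + ∑ k, (Real.exp (e k.succ * t)) • S k).det ≠ 0) →
        ∀ (Z : Finset ℝ) (m : ℝ → ℕ),
          (∀ z ∈ Z, ∀ j < m z,
            iteratedDeriv j (fun t => ((Real.exp (e 0 * t)) • (τ + t • T) + ∑ k, (Real.exp (e k.succ * t)) • S k).det) z = 0) →
          ∑ z ∈ Z, m z ≤ 19)
    (hchain : ∀ (δs : ℕ → Fin 6 → ℝ) (δ0 : Fin 6 → ℝ),
      (∀ l, Tendsto (fun ν => δs ν l) atTop (𝓝 (δ0 l))) → δ0 5 = δ0 0 →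
      (∀ a b c d : Fin 5, δ0 a.castSucc + δ0 b.castSucc = δ0 c.castSucc + δ0 d.castSucc → (a = c ∧ b = d) ∨ (a = d ∧ b = c)) →
      ∀ (U : ℕ → Fin 6 → Matrix (Fin 2) (Fin 2) ℝ), (∀ ν l, (U ν l).IsSymm) →
      (∀ ν, ∃ t, (∑ l, Real.exp (δs ν l * t) • U ν l).det ≠ 0) →
      ∀ (z : ℕ → Fin 20 → ℝ), (∀ ν, StrictMono (z ν)) → (∀ ν i, (∑ l, Real.exp (δs ν l * z ν i) • U ν l).det = 0) →
      ∀ (φ : ℕ → ℕ), StrictMono φ →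
      ∀ (C : ℕ) (m : Fin C → ℕ) (s : Fin C → ℕ → ℝ) (R : ℝ)
        (μ : Fin C → ℕ → ℝ) (Γ : Fin C → Fin 6 → Fin 6 → ℝ) (ε : Fin C → ℝ) (W : Fin C → Fin 6 → Matrix (Fin 2) (Fin 2) ℝ),
      ∑ c, m c = 20 → (∀ c, 1 ≤ m c) →
      (∀ c c' : Fin C, c < c' → Tendsto (fun k => s c' k - s c k) atTop atTop) →
      (∀ (c : Fin C) (k : ℕ), ∃ x : Fin (m c) → ℝ, StrictMono x ∧ ∀ i, x i ∈ Set.Icc (-R) R ∧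
        (∑ l, Real.exp (δs (φ k) l * x i) • (Real.exp (δs (φ k) l * s c k) • U (φ k) l)).det = 0) →
      (∀ c : Fin C,
        (∀ k, 0 < μ c k) ∧
        (∀ k a b, |polar
          (if a = 0 then Real.exp (δs (φ k) 0 * s c k) • U (φ k) 0 + Real.exp (δs (φ k) 5 * s c k) • U (φ k) 5
            else if a = 5 then (δs (φ k) 5 - δs (φ k) 0) • (Real.exp (δs (φ k) 5 * s c k) • U (φ k) 5)
            else Real.exp (δs (φ k) a * s c k) • U (φ k) a)
          (if b = 0 then Real.exp (δs (φ k) 0 * s c k) • U (φ k) 0 + Real.exp (δs (φ k) 5 * s c k) • U (φ k) 5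
            else if b = 5 then (δs (φ k) 5 - δs (φ k) 0) • (Real.exp (δs (φ k) 5 * s c k) • U (φ k) 5)
            else Real.exp (δs (φ k) b * s c k) • U (φ k) b)| ≤ μ c k) ∧
        (∀ a b, Tendsto (fun k => polar
          (if a = 0 then Real.exp (δs (φ k) 0 * s c k) • U (φ k) 0 + Real.exp (δs (φ k) 5 * s c k) • U (φ k) 5
            else if a = 5 then (δs (φ k) 5 - δs (φ k) 0) • (Real.exp (δs (φ k) 5 * s c k) • U (φ k) 5)
            else Real.exp (δs (φ k) a * s c k) • U (φ k) a)
          (if b = 0 then Real.exp (δs (φ k) 0 * s c k) • U (φ k) 0 + Real.exp (δs (φ k) 5 * s c k) • U (φ k) 5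
            else if b = 5 then (δs (φ k) 5 - δs (φ k) 0) • (Real.exp (δs (φ k) 5 * s c k) • U (φ k) 5)
            else Real.exp (δs (φ k) b * s c k) • U (φ k) b) / μ c k) atTop (𝓝 (Γ c a b))) ∧
        (ε c = 1 ∨ ε c = -1) ∧ (∀ l, (W c l).IsSymm) ∧ (∀ a b, Γ c a b = ε c * polar (W c a) (W c b)) ∧
        (∃ t, ((Real.exp (δ0 0 * t)) • (W c 0 + t • W c 5)
          + ∑ k : Fin 4, (Real.exp (δ0 k.succ.castSucc * t)) • W c k.succ.castSucc).det ≠ 0) ∧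
        ∀ (n : ℕ) (ψ : ℕ → ℕ), StrictMono ψ → ∀ (ts : ℕ → ℝ) (t₀ : ℝ), Tendsto ts atTop (𝓝 t₀) →
          Tendsto (fun k => iteratedDeriv n
              (fun t => ε c * (μ c (ψ k))⁻¹ *
                (∑ l, Real.exp (δs (φ (ψ k)) l * t) • (Real.exp (δs (φ (ψ k)) l * s c (ψ k)) • U (φ (ψ k)) l)).det) (ts k))
            atTop (𝓝 (iteratedDeriv n
              (fun t => ((Real.exp (δ0 0 * t)) • (W c 0 + t • W c 5)
                + ∑ k : Fin 4, (Real.exp (δ0 k.succ.castSucc * t)) • W c k.succ.castSucc).det) t₀))) →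
      ((univ : Finset (Fin 6 × Fin 6)).image (fun pq => δ0 pq.1 + δ0 pq.2)).card = 15 →
      (∀ c : Fin C, m c + 1 = ∑ w ∈ ((univ : Finset (Fin 6 × Fin 6)).image (fun pq => δ0 pq.1 + δ0 pq.2)).filter
          (fun w => (∃ p q : Fin 6, δ0 p + δ0 q = w ∧ polar (W c p) (W c q) ≠ 0)),
        ((if δ0 0 + δ0 0 = w ∧ polar (W c 5) (W c 5) ≠ 0 then 2 else if (∃ q : Fin 6, q ≠ 5 ∧ δ0 5 + δ0 q = w ∧ polar (W c 5) (W c q) ≠ 0) then 1 else 0) + 1)) →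
      (∀ c c' : Fin C, c < c' → ∀ p q p' q' : Fin 6,
        polar (W c p) (W c q) ≠ 0 → polar (W c' p') (W c' q') ≠ 0 → δ0 p + δ0 q ≤ δ0 p' + δ0 q') →
      (∑ c : Fin C, ((((univ : Finset (Fin 6 × Fin 6)).image (fun pq => δ0 pq.1 + δ0 pq.2)).filter
          (fun w => (∃ p q : Fin 6, δ0 p + δ0 q = w ∧ polar (W c p) (W c q) ≠ 0))).card - 1) = 14) →
      (∀ w ∈ ((univ : Finset (Fin 6 × Fin 6)).image (fun pq => δ0 pq.1 + δ0 pq.2)),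
        (∑ c : Fin C, if (∃ p q : Fin 6, δ0 p + δ0 q = w ∧ polar (W c p) (W c q) ≠ 0)
          then (if δ0 0 + δ0 0 = w ∧ polar (W c 5) (W c 5) ≠ 0 then 2 else if (∃ q : Fin 6, q ≠ 5 ∧ δ0 5 + δ0 q = w ∧ polar (W c 5) (W c q) ≠ 0) then 1 else 0) else 0)
        = (if w = δ0 0 + δ0 0 then 3 else if (∃ q : Fin 6, q ≠ 0 ∧ q ≠ 5 ∧ w = δ0 0 + δ0 q) then 2 else 1) - 1) →
      2 ≤ C → False) :
    ∀ δ : Fin 6 → ℝ, δ ∈ SortedSimplex → ∀ i j : Fin 6,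
      (i < j ∧ δ i = δ j ∧ Set.InjOn (fun p : Fin 5 × Fin 5 => δ (j.succAbove p.1) + δ (j.succAbove p.2)) {p | p.1 ≤ p.2}) →
      δ ∉ closure TwentyLocus := by
  intro δ0 _ i j hgen hcl
  classical
  obtain ⟨hij, hδij, hinj⟩ := hgen
  -- (1) a sequence of twenties converging to `δ0`
  obtain ⟨δseq, hmem, hlim⟩ := mem_closure_iff_seq_limit.mp hcl
  choose S hS hneS z hz hroot using fun ν => twenty_log_zeros_of_mem_twentyLocus (hmem ν)
  have hδ : ∀ l, Tendsto (fun ν => δseq ν l) atTop (𝓝 (δ0 l)) := fun l => (tendsto_pi_nhds.mp hlim) l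
  -- (2) relabel so that the Weyl pair sits at the positions `0, 5`
  obtain ⟨σ, hσ5, hσ0, π, hσ⟩ := exists_perm_weylPair i j (ne_of_lt hij)
  have hsum : ∀ (δ : Fin 6 → ℝ) (V : Fin 6 → Matrix (Fin 2) (Fin 2) ℝ) (t : ℝ),
      ∑ l, Real.exp (δ (σ l) * t) • V (σ l) = ∑ l, Real.exp (δ l * t) • V l :=
    fun δ V t => Equiv.sum_comp σ (fun l => Real.exp (δ l * t) • V l)
  have h05 : δ0 (σ 5) = δ0 (σ 0) := by rw [hσ5, hσ0, hδij]
  have hsid : ∀ a b c d : Fin 5, δ0 (σ a.castSucc) + δ0 (σ b.castSucc) = δ0 (σ c.castSucc) + δ0 (σ d.castSucc) →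
      (a = c ∧ b = d) ∨ (a = d ∧ b = c) := by
    intro a b c d h
    simp only [hσ] at h
    exact sidon_of_injOn δ0 j hinj π a b c d h
  -- (3) the structure theorem for the relabelled data
  obtain ⟨φ, hφ, C, m, s, R, μ, Γ, ε, W, hm, hmpos, hdrift, hzeros, hpkg, hV, hsharp, hmono, hint, hsplit⟩ :=
    tightChain (fun ν l => δseq ν (σ l)) (fun l => δ0 (σ l)) (fun l => hδ (σ l)) h05 hsid
      (fun ν l => S ν (σ l)) (fun ν l => hS ν (σ l))
      (fun ν => by obtain ⟨t, ht⟩ := hneS ν; exact ⟨t, by rw [hsum]; exact ht⟩)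
      z hz (fun ν i' => by rw [hsum]; exact hroot ν i')
  -- (4) exits
  by_cases hC : 2 ≤ C
  · exact hchain (fun ν l => δseq ν (σ l)) (fun l => δ0 (σ l)) (fun l => hδ (σ l)) h05 hsid
      (fun ν l => S ν (σ l)) (fun ν l => hS ν (σ l))
      (fun ν => by obtain ⟨t, ht⟩ := hneS ν; exact ⟨t, by rw [hsum]; exact ht⟩)
      z hz (fun ν i' => by rw [hsum]; exact hroot ν i')
      φ hφ C m s R μ Γ ε W hm hmpos hdrift hzeros hpkg hV hsharp hmono hint hsplit hC
  · -- one cluster: all twenty zeros in the window of cluster `0`; the door forbids it (#16)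
    have hC1 : C = 1 := by
      have hCpos : 0 < C := by
        rcases Nat.eq_zero_or_pos C with h0 | h0
        · subst h0
          simp at hm
        · exact h0
      omega
    subst hC1
    have hm0 : m 0 = 20 := by simpa using hm
    refine no_twenty_window_weyl05_of_confluentDoor hdoor (fun ν l => δseq (φ ν) (σ l)) (fun l => δ0 (σ l))
      (fun l => (hδ (σ l)).comp hφ.tendsto_atTop) h05 hsid
      (fun k l => Real.exp (δseq (φ k) (σ l) * s 0 k) • S (φ k) (σ l)) (fun k l => (hS (φ k) (σ l)).smul _) ?_ (-R) R ?_
    · -- the recentred pencils are not identically zero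
      intro k
      obtain ⟨t, ht⟩ := hneS (φ k)
      refine ⟨t - s 0 k, ?_⟩
      rw [← pencil_recenter, add_sub_cancel, hsum]
      exact ht
    · -- twenty zeros in the window
      intro k
      obtain ⟨x, hx, hx'⟩ := hzeros 0 k
      exact ⟨fun i' => x (Fin.cast hm0.symm i'), fun a b hab => hx hab, fun i' => ⟨(hx' _).1, (hx' _).2⟩⟩

end Summit.ValiantsHypothesis.ValiantsHypothesis.Theorems.LacunarySymmetroidMatrixDescartes.WallBubbling
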